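import Literature.Geometry.Lorentzian.ParametricAnnulusGluing
import Literature.Geometry.Lorentzian.AdmissibleDataLocality
import Literature.Geometry.Lorentzian.TameGenericityLocal
import Literature.Geometry.Lorentzian.TameGenericityLocalWindowImmersed
import Summits.FinalStateConjecture.FinalStateConjecture.Theorems.LaminatedThresholdTameExitsLocaliseSquash

/-!
# Crux `TameExitsLocalise` (stmt-FinalStateConjecture-16894) · S1 `ParametricTailGluing` from the
# Chruściel–Delay parametric annular gluing fact

Helper file of prover seat 1 (route-affinity, route `LaminatedThreshold`) for the birth skeleton
`Cruxes/TameExitsLocalise/Lines/birth.lean` — `--supports stmt-FinalStateConjecture-16894`.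

* `parametricTailGluing_of_annulusGluing` (registered support stub) — the ELLIPTIC HALF S1 of the line,
  VERBATIM the body of `Birth.ParametricTailGluing` (with `NoKillingTail e d⋆` unfolded, the skeleton's
  vocabulary not being importable here), from the named fact
  `Literature.Geometry.Lorentzian.ChruscielDelay_parametricAnnulusGluing` (`ParametricAnnulusGluing.lean`):
  for an admissible `d⋆` with a tame, immersed, injective, admissible exit family `F` on the end `e` and
  KID-free chart annuli beyond every radius, beyond every `R₀` there are `R₁ ≥ R₀`, a family `F'` and
  `ε₁ > 0` with `F'` jointly smooth, immersed at `0`, through `d⋆`, injective, admissible, equal to `d⋆`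
  off ONE compact set and equal to `F c` off `e.far R₁` whenever `‖c‖ < ε₁`. So the skeleton's
  `stub_parametricTailGluing` holds conditionally on that one fact:
  `fun h ↦ parametricTailGluing_of_annulusGluing h` (definitional unfolding of `NoKillingTail`).

Plumbing (all in the tree): the immersion witness `(x₀, u, w)` of `F` at `e₀`
(`IsImmersedAtZero 1 F`); a radius `Rx` with `x₀ ∉ e.far R` for `R ≥ Rx`
(`AFEnd.exists_nhds_forall_disjoint_far`); the KID-free annulus `R₁ < R₂` beyond `max R₀ Rx` (hypothesis);
the glued family `G` of the fact (`G c = F c` off `e.far R₁` for `‖c‖ < ε`, `G c = d⋆` on `e.far R₂`);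
`G` is immersed at `0` because its scalar components at `x₀` coincide with those of `F` near `c = 0`
(`isImmersedAtZero_of_agree`); hence injective on a window `‖c‖ < δ`
(`InitialDataSet.exists_window_injective_of_isImmersedAtZero`); the smooth injective squash `Φ` of `ℝ¹` into
the `min δ ε`-ball with `Φ = id` on `‖c‖ < a` (`exists_contDiff_squash_eqOn`, landed by seat 0 in
`LaminatedThresholdTameExitsLocaliseSquash.lean`); `F' := G ∘ Φ` is jointly smooth
(`IsSmoothDataFamily.comp_contDiff`), immersed (`IsImmersedAtZero.comp_of_injective_fderiv`, `dΦ₀ = id`),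
injective, admissible member by member (`InitialDataSet.mem_admissibleVacuumData_of_agree_off_compact` with the
compact set `(e.far R₂)ᶜ`, `AFEnd.IsSoleEnd.isCompact_compl_far`, the end being sole by tameness), and
`F' c = G c = F c` off `e.far R₁` for `‖c‖ < min a ε`.
-/

noncomputable section

-- `Summit.FinalStateConjecture.FinalStateConjecture.…` is the mandated Theorems namespace (summit = problem name).
set_option linter.dupNamespace false

open Set Filter Function
open scoped _root_.Manifold _root_.ContDiff _root_.Topology
open Literature.Geometry.Lorentzian

namespace Summit.FinalStateConjecture.FinalStateConjecture.Theorems.LaminatedThreshold.TailGluing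

section Immersion

variable {X : Type} [TopologicalSpace X] [ChartedSpace E3 X] [IsManifold (𝓡 3) ∞ X]

/-- `e₀ ≠ 0` in `ℝ¹`. -/
theorem single_one_ne_zero : (EuclideanSpace.single 0 (1 : ℝ) : EuclideanSpace ℝ (Fin 1)) ≠ 0 := by
  intro h
  have := congrArg (fun v : EuclideanSpace ℝ (Fin 1) ↦ v 0) h
  simp at this

/-- Every `v ∈ ℝ¹` is `(v 0) • e₀`. -/
theorem eq_smul_single (v : EuclideanSpace ℝ (Fin 1)) :
    v = (v 0) • (EuclideanSpace.single 0 (1 : ℝ) : EuclideanSpace ℝ (Fin 1)) := by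
  ext i
  have hi : i = 0 := Subsingleton.elim i 0
  subst hi
  simp

/-- **Immersion at `0` passes to a family with the same scalar components at the witness point near
`c = 0`.** If `F` has an immersion witness `(x₀, u, w)` in the direction `e₀` and the sections of `G c`
and `F c` agree at `x₀` whenever `‖c‖ < ε`, then `G` is immersed at `0` (one-parameter families: every
direction `v ≠ 0` is `(v 0) • e₀`, and the `fderiv`s of eventually equal functions agree). -/
theorem isImmersedAtZero_of_agree {F G : EuclideanSpace ℝ (Fin 1) → InitialDataSet (𝓡 3) X} {x₀ : X}
    {ε : ℝ} (hε : 0 < ε)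
    (hagree : ∀ c : EuclideanSpace ℝ (Fin 1), ‖c‖ < ε →
      (G c).h.inner x₀ = (F c).h.inner x₀ ∧ (G c).k x₀ = (F c).k x₀)
    (u w : TangentSpace (𝓡 3) x₀)
    (huw : fderiv ℝ (fun c ↦ (F c).h.inner x₀ u w) 0 (EuclideanSpace.single 0 (1 : ℝ)) ≠ 0 ∨
      fderiv ℝ (fun c ↦ (F c).k x₀ u w) 0 (EuclideanSpace.single 0 (1 : ℝ)) ≠ 0) :
    InitialDataSet.IsImmersedAtZero 1 G := by
  intro v hv
  refine ⟨x₀, u, w, ?_⟩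
  have hball : Metric.ball (0 : EuclideanSpace ℝ (Fin 1)) ε ∈ 𝓝 (0 : EuclideanSpace ℝ (Fin 1)) :=
    Metric.ball_mem_nhds 0 hε
  have h1 : (fun c ↦ (G c).h.inner x₀ u w) =ᶠ[𝓝 0] fun c ↦ (F c).h.inner x₀ u w := by
    filter_upwards [hball] with c hc
    rw [(hagree c (mem_ball_zero_iff.1 hc)).1]
  have h2 : (fun c ↦ (G c).k x₀ u w) =ᶠ[𝓝 0] fun c ↦ (F c).k x₀ u w := by
    filter_upwards [hball] with c hc
    rw [(hagree c (mem_ball_zero_iff.1 hc)).2]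
  rw [h1.fderiv_eq, h2.fderiv_eq]
  have hv0 : v 0 ≠ 0 := by
    intro h
    apply hv
    rw [eq_smul_single v, h, zero_smul]
  rw [eq_smul_single v, map_smul, map_smul, smul_eq_mul, smul_eq_mul]
  rcases huw with h | h
  · exact Or.inl (mul_ne_zero hv0 h)
  · exact Or.inr (mul_ne_zero hv0 h)

end Immersion

/-- **S1 `ParametricTailGluing` of crux `TameExitsLocalise` from the Chruściel–Delay parametric annular
gluing fact** (registered support stub; the body of `Birth.ParametricTailGluing` verbatim with
`NoKillingTail e dstar` unfolded). See the module docstring for the plumbing. -/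
theorem parametricTailGluing_of_annulusGluing : Literature.Geometry.Lorentzian.ChruscielDelay_parametricAnnulusGluing → ∀ (X : Type) [TopologicalSpace X] [ChartedSpace Literature.Geometry.Lorentzian.E3 X] [IsManifold (𝓡 3) ((⊤ : ℕ∞) : WithTop ℕ∞) X] [T2Space X] [SecondCountableTopology X] [ConnectedSpace X] (e : Literature.Geometry.Lorentzian.AFEnd X) (dstar : Literature.Geometry.Lorentzian.InitialDataSet (𝓡 3) X) (F : EuclideanSpace ℝ (Fin 1) → Literature.Geometry.Lorentzian.InitialDataSet (𝓡 3) X), dstar ∈ Literature.Geometry.Lorentzian.admissibleVacuumData X → Literature.Geometry.Lorentzian.InitialDataSet.IsTameDataFamily e 1 F → Literature.Geometry.Lorentzian.InitialDataSet.IsImmersedAtZero 1 F → F 0 = dstar → Function.Injective F → (∀ c, F c ∈ Literature.Geometry.Lorentzian.admissibleVacuumData X) → (∀ R₀ : ℝ, ∃ R₁ R₂ : ℝ, R₀ ≤ R₁ ∧ e.R ≤ R₁ ∧ R₁ < R₂ ∧ ¬ ∃ (N : Literature.Geometry.Lorentzian.E3 → ℝ) (Y : Literature.Geometry.Lorentzian.E3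 → Literature.Geometry.Lorentzian.E3), ContDiffOn ℝ ((⊤ : ℕ∞) : WithTop ℕ∞) N {y : Literature.Geometry.Lorentzian.E3 | R₁ < ‖y‖ ∧ ‖y‖ < R₂} ∧ ContDiffOn ℝ ((⊤ : ℕ∞) : WithTop ℕ∞) Y {y : Literature.Geometry.Lorentzian.E3 | R₁ < ‖y‖ ∧ ‖y‖ < R₂} ∧ (∃ y : Literature.Geometry.Lorentzian.E3, R₁ < ‖y‖ ∧ ‖y‖ < R₂ ∧ (N y ≠ 0 ∨ Y y ≠ 0)) ∧ ∀ y : Literature.Geometry.Lorentzian.E3, R₁ < ‖y‖ → ‖y‖ < R₂ → Literature.Geometry.Lorentzian.MetricCoord.adjHamG (e.hCoeff dstar) (e.kCoeff dstar) N y + Literature.Geometry.Lorentzian.MetricCoord.adjMomGS (e.hCoeff dstar) (e.kCoeff dstar) Y y = 0 ∧ Literature.Geometry.Lorentzian.MetricCoord.adjHamK (e.hCoeff dstar) (e.kCoeff dstar) N y + Literature.Geometry.Lorentzian.MetricCoord.adjMomKS (e.hCoeff dstar) Y y = 0) → ∀ R₀ : ℝ, ∃ R₁ : ℝ, R₀ ≤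 R₁ ∧ ∃ (F' : EuclideanSpace ℝ (Fin 1) → Literature.Geometry.Lorentzian.InitialDataSet (𝓡 3) X) (ε₁ : ℝ), Literature.Geometry.Lorentzian.InitialDataSet.IsSmoothDataFamily 1 F' ∧ Literature.Geometry.Lorentzian.InitialDataSet.IsImmersedAtZero 1 F' ∧ F' 0 = dstar ∧ Function.Injective F' ∧ (∀ c, F' c ∈ Literature.Geometry.Lorentzian.admissibleVacuumData X) ∧ (∃ C : Set X, IsCompact C ∧ ∀ c, ∀ x ∉ C, (F' c).h.inner x = dstar.h.inner x ∧ (F' c).k x = dstar.k x) ∧ 0 < ε₁ ∧ ∀ c, ‖c‖ < ε₁ → ∀ x ∉ e.far R₁, (F' c).h.inner x = (F c).h.inner x ∧ (F' c).k x = (F c).k x := by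
  intro hglue X _ _ _ _ _ _ e dstar F hd hF himm hF0 _hFinj hFadm hnokid R₀
  -- the immersion witness of `F` at `e₀`, and a radius beyond it
  obtain ⟨x₀, u, w, huw⟩ := himm _ single_one_ne_zero
  obtain ⟨V, hV, Rx, hRx⟩ := e.exists_nhds_forall_disjoint_far x₀
  have hx₀V : x₀ ∈ V := mem_of_mem_nhds hV
  -- the KID-free annulus beyond `max R₀ Rx`
  obtain ⟨R₁, R₂, hR₀₁, heR₁, hR₁₂, hkid⟩ := hnokid (max R₀ Rx)
  have hx₀far : x₀ ∉ e.far R₁ := fun hx ↦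
    Set.disjoint_left.1 (hRx R₁ ((le_max_right _ _).trans hR₀₁)) hx hx₀V
  -- vacuum clauses
  have hdvac : ∀ [dstar.metric.HasLeviCivita], dstar.IsVacuumConstraintSolution := by
    intro inst
    exact hd.1.1
  have hFvac : ∀ c, ∀ [(F c).metric.HasLeviCivita], (F c).IsVacuumConstraintSolution := by
    intro c inst
    exact (hFadm c).1.1
  have hsole : e.IsSoleEnd := hF.2.1
  -- glue
  obtain ⟨G, ε, hε, hG, hG0, hGvac, hGF, hGd⟩ :=
    hglue X e dstar F R₁ R₂ hdvac hF.1 hF0 hFvac heR₁ hR₁₂ hkid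
  -- `G` is immersed at `0`, hence injective on a window
  have hGimm : InitialDataSet.IsImmersedAtZero 1 G :=
    isImmersedAtZero_of_agree hε (fun c hc ↦ hGF c hc x₀ hx₀far) u w huw
  obtain ⟨δ, hδ, hGinj⟩ := InitialDataSet.exists_window_injective_of_isImmersedAtZero hG hGimm
  -- squash the parameter line into the `min δ ε`-ball, identically near `0`
  obtain ⟨Φ, a, ha, hΦ, hΦinj, hΦlt, hΦid⟩ := exists_contDiff_squash_eqOn (lt_min hδ hε)
  have hΦ0 : Φ 0 = 0 := hΦid 0 (by simpa using ha)
  have hΦev : Φ =ᶠ[𝓝 0] id := by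
    filter_upwards [Metric.ball_mem_nhds (0 : EuclideanSpace ℝ (Fin 1)) ha] with c hc
    exact hΦid c (mem_ball_zero_iff.1 hc)
  have hfd : fderiv ℝ Φ 0 = ContinuousLinearMap.id ℝ (EuclideanSpace ℝ (Fin 1)) := by
    rw [hΦev.fderiv_eq, fderiv_id]
  have hΦδ : ∀ c, ‖Φ c‖ < δ := fun c ↦ lt_of_lt_of_le (hΦlt c) (min_le_left _ _)
  have hΦε : ∀ c, ‖Φ c‖ < ε := fun c ↦ lt_of_lt_of_le (hΦlt c) (min_le_right _ _)
  -- the witness family `F' := G ∘ Φ`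
  refine ⟨R₁, (le_max_left _ _).trans hR₀₁, fun c ↦ G (Φ c), min a ε, hG.comp_contDiff hΦ, ?_, ?_, ?_,
    ?_, ?_, lt_min ha hε, ?_⟩
  · exact hGimm.comp_of_injective_fderiv hΦ0 (hΦ.differentiable (by simp) 0)
      (by rw [hfd]; exact injective_id)
  · show G (Φ 0) = dstar
    rw [hΦ0, hG0]
  · exact fun c c' h ↦ hΦinj (hGinj _ _ (hΦδ c) (hΦδ c') h)
  · exact fun c ↦ InitialDataSet.mem_admissibleVacuumData_of_agree_off_compact hd (hGvac (Φ c))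
      (hsole.isCompact_compl_far R₂) fun x hx ↦ hGd (Φ c) x (by simpa using hx)
  · exact ⟨(e.far R₂)ᶜ, hsole.isCompact_compl_far R₂, fun c x hx ↦ hGd (Φ c) x (by simpa using hx)⟩
  · intro c hc x hx
    have hca : ‖c‖ < a := lt_of_lt_of_le hc (min_le_left _ _)
    have hce : ‖c‖ < ε := lt_of_lt_of_le hc (min_le_right _ _)
    show (G (Φ c)).h.inner x = (F c).h.inner x ∧ (G (Φ c)).k x = (F c).k x
    rw [hΦid c hca]
    exact hGF c hce x hx

end Summit.FinalStateConjecture.FinalStateConjecture.Theorems.LaminatedThreshold.TailGluing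

end
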